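import Summits.BirchSwinnertonDyer.BirchSwinnertonDyer.Theorems.Rank1ResidualX9CMPartner
import Literature.NumberTheory.EllipticCurves.Rank1Residual.X9ChaCertificate
import Literature.NumberTheory.EllipticCurves.Rank1Residual.X9MuInvariant
import HarnessLib

/-!
# BSD rank-≤1 residual cell, class X9: the typed target DELIVERED POINTWISE by the Cha (Heegner-index)
# certificate at a NON-surjective irreducible prime

HONEST FRAMING (cell `b2b-bsdres-*`, verbatim): the goal of the cell is to DELETE the
COMBINATION-SHAPED residual classes for ALL analytic-rank ≤ 1 curves over ℚ — "full BSD formula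
for every rank ≤ 1 curve in class C" assembled STRICTLY from published theorems — so that the
rank-≤1 remainder becomes exactly the CONSTRUCTION-SHAPED classes, which are TYPED (missing-input
Props), NOT attempted; this is not "finishing BSD".

Theorems only (helper file of the statement item `SelmerRankSmallImage`,
stmt-BirchSwinnertonDyer-14418, like `Rank1ResidualX9Defs.lean` (gen 1: typed target
`BSDpOnClassX9`, missing input `IntegralMainConjectureOnClassX9`), `Rank1ResidualX9CMPartner.lean`
(gen 4, route U1′) and `Rank1ResidualX9TrivialPartner.lean` (gen 5, routes U2/U2′, μ-typing)).
X9 prover gen 6 adds the PER-CURVE route that needs no congruent partner at all: Cha's extension of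
Kolyvagin's Heegner-index bound to IRREDUCIBLE mod-`p` representations (J. Number Theory 111
(2005); as printed by Miller 2011 Thm. 5.2 and Grigorov–Jorza–Patrikis–Stein–Tarniţă 2009 Thm. 3.5;
tree fact `Cha2005.thm52_padicValNat_shaOrder_le`, consumer `Rank1Residual/X9ChaCertificate.lean`).
On this file's `ClassX9` (¬cm ∧ `p ≥ 5` ∧ good ∧ ordinary ∧ irr ∧ ¬surj) the Galois hypotheses of
Cha's theorem are AUTOMATIC (`E` non-CM, `E[p]` irreducible, `p` odd), and the surjective Kolyvagin
certificate of the tree is unusable (`¬surj`); what remains per pair is the finite certificate — a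
Heegner field `K` with `p ∤ d_K` (and `p² ∤ N`, automatic for a good `p` when `N = N_E`), a
Heegner point `y_K` of infinite order, and `p ∤ [E(K) : ℤ y_K]` — plus `p ∤ #Ш_an`.
* `bsdp_of_classX9_of_chaCertificate` — Miller's `BSDp W p` in analytic rank `≤ 1` on the
  Cha-certificate locus of `ClassX9` (re-export of `Typed.X9.bsdp_of_cha_of_not_dvd_index` through
  `classX9_census_of_classX9`);
* `mu_eq_zero_of_classX9_of_chaCertificate` — in analytic rank `0`, at such a pair Greenberg's
  `μ = 0` for `X(E/ℚ_∞)` FOLLOWS (gen 5's μ-typing `Rank1Residual.X9.mu_eq_zero_of_bsdp`, granted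
  the finite analytic certificate `hcert` = one unit coefficient of `ϖ·L_p(f,α)`): on the
  Cha-certificate locus the typed residue of class X9 is not merely bypassed but SETTLED.
Census (RESIDUAL-CASES §a.2 X9, N < 2·10⁴, all at `p = 5`; cell job records
`HOME/b2b-bsdres-x9/g6/`): the certificate is held (two PARI runs + PARI-free discrete checks;
the lane re-certifies) at 2268b1, 8092a1 (`K = ℚ(√−47)`), 11552j1 (`ℚ(√−31)`), 12996c1, 12996d1
(`ℚ(√−71)`), 17298b1 (`ℚ(√−23)`), 7688j1, 7688k1 (`ℚ(√−79)`); nothing here claims the class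
closed: `BSDpOnClassX9` and `IntegralMainConjectureOnClassX9` stay OPEN as ∀-statements.
-/

set_option linter.dupNamespace false

noncomputable section

open scoped Classical MatrixGroups ModularForm

open CongruenceSubgroup WeierstrassCurve Literature.NumberTheory.EllipticCurves
  Literature.NumberTheory.EllipticCurves.ModularForms
  Literature.NumberTheory.EllipticCurves.Rank1Residual
  Literature.NumberTheory.EllipticCurves.Cha2005

namespace Summit.BirchSwinnertonDyer.BirchSwinnertonDyer.Rank1Residual

/-- **`BSD(E,p)` on the Cha-certificate locus of class X9, analytic rank `≤ 1`** — the typed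
target `BSDpOnClassX9` delivered pointwise (in Miller's currency `BSDp`), over this file's
`ClassX9`, for every image type of `ρ̄_{E,p}` and WITHOUT any congruent partner. PUBLISHED binders:
Cha 2005 (`hCha` = `Cha2005.thm52_padicValNat_shaOrder_le`, flag `Cha05-primary-unread`) and
Gross–Zagier–Kolyvagin (`hGZK`, bsd.S17); the certificate: an imaginary quadratic `K` with the
Heegner hypothesis for the level `N` and `p ∤ d_K`, `p² ∤ N`, a Heegner point `P` of infinite order
with `p ∤ [E(K) : ℤ P]`, and `#Ш_an = q` with `ord_p q = 0`. Re-export of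
`Rank1Residual.Typed.X9.bsdp_of_cha_of_not_dvd_index`. [cite: Miller2011LMS, Thm. 5.2 and Def. 1.1]
[cite: GrigorovJorzaPatrikisSteinTarnita2009, Thm. 3.5 and Rem. 3.6] -/
theorem bsdp_of_classX9_of_chaCertificate (hCha : thm52_padicValNat_shaOrder_le)
    (hGZK : rank_eq_analyticRank_of_analyticRank_le_one)
    (W : WeierstrassCurve ℚ) [W.IsElliptic] [W.IsGloballyMinimal] (p : ℕ) [Fact p.Prime]
    (hX9 : ClassX9 W p) {N : ℕ} [NeZero N] {K : Type} [Field K] [NumberField K]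
    (hK : IsImaginaryQuadratic K) (hH : SatisfiesHeegnerHypothesis N K)
    {P : (W.baseChange K).toAffine.Point} (hP : IsHeegnerPoint N W K P) (hnt : ¬ IsOfFinAddOrder P)
    (hpD : ¬ (p : ℤ) ∣ NumberField.discr K) (hpN : ¬ p ^ 2 ∣ N)
    (hI : ¬ p ∣ (AddSubgroup.zmultiples P).index)
    (hran : W.analyticRank ≤ 1) {q : ℚ} (hq : shaAn W = (q : ℂ)) (hv : padicValRat p q = 0) :
    BSDp W p :=
  Typed.X9.bsdp_of_cha_of_not_dvd_index W p hCha hGZK (classX9_census_of_classX9 W p hX9) hK hH hP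
    hnt hpD hpN hI hran hq hv

/-- **On the Cha-certificate locus of class X9 in analytic rank `0`, Greenberg's `μ = 0` holds.**
Granted the finite analytic certificate `hcert` (one unit coefficient of the `Ω⁺_f`-normalised
`p`-adic `L`-function `ϖ·L_p(f, α)` at level `N_E`; for a pair with `p ∤ (a_p − 1)·∏c_ℓ·#Ш_an` the
constant coefficient), the Cha certificate gives `BSDp W p` (previous theorem) and gen 5's
μ-typing converse `Rank1Residual.X9.mu_eq_zero_of_bsdp` (Burungale–Castella–Skinner 2025
Thm. 1.1.2 (a) `hBCS`, Greenberg LNM 1716 Thm. 4.1 `hGr`, the period unit `h5`, modularity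
`hmodP`/`hmodL`, GZK) turns it into `D.mu = 0` for every cyclotomic dual datum `D` of `X(E/ℚ_∞)`:
at such pairs the typed residue of class X9 (Greenberg's Conj. 1.11 instance,
`bsdpOnClassX9_at_iff_mu_eq_zero`) is settled, not bypassed. Per pair; not a class theorem.
[cite: Miller2011LMS, Thm. 5.2] [cite: GreenbergLNM1716, Conj. 1.11 and Thm. 4.1 (p. 102)]
[cite: BurungaleCastellaSkinner2025, Thm. 1.1.2 (a)] -/
theorem mu_eq_zero_of_classX9_of_chaCertificate (hCha : thm52_padicValNat_shaOrder_le)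
    (hBCS : burungale_castella_skinner_charIdeal_eq_padicLFunction)
    (hGr : greenberg_charValue_rankZero) (h5 : realPeriodRat_eq_unit_mul_plusPeriod)
    (hmodP : nonempty_modularParametrizationData) (hmodL : hasEntireLFunction_rat)
    (hGZK : rank_eq_analyticRank_of_analyticRank_le_one)
    (W : WeierstrassCurve ℚ) [W.IsElliptic] [W.IsGloballyMinimal] (p : ℕ) [Fact p.Prime]
    (hX9 : ClassX9 W p) (hr0 : W.analyticRank = 0) {N : ℕ} [NeZero N] {K : Type} [Field K]
    [NumberField K] (hK : IsImaginaryQuadratic K) (hH : SatisfiesHeegnerHypothesis N K)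
    {P : (W.baseChange K).toAffine.Point} (hP : IsHeegnerPoint N W K P) (hnt : ¬ IsOfFinAddOrder P)
    (hpD : ¬ (p : ℤ) ∣ NumberField.discr K) (hpN : ¬ p ^ 2 ∣ N)
    (hI : ¬ p ∣ (AddSubgroup.zmultiples P).index) {q : ℚ} (hq : shaAn W = (q : ℂ))
    (hv : padicValRat p q = 0)
    (hcert : ∀ [NeZero (W.conductorNorm ℤ)] (f : CuspForm (Gamma0 (W.conductorNorm ℤ)) 2),
        IsNewformOf W f → ∀ (ϖ : ℚ), (ϖ : ℝ) * W.realPeriodRat = plusPeriod f →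
      ∃ n : ℕ, ‖PowerSeries.coeff n
        (PowerSeries.C (ϖ : ℚ_[p]) * padicLFunction f (unitRoot W p : ℚ_[p]))‖ = 1) :
    ∀ (κ : ZpExtension ℚ p) (γ : Field.absoluteGaloisGroup ℚ),
        κ.IsCyclotomic → κ.IsTopGenerator γ → IsCyclotomicVariable p γ →
      ∀ (D : W.SelmerDualData κ γ), D.mu = 0 := by
  have hbsd : BSDp W p :=
    bsdp_of_classX9_of_chaCertificate hCha hGZK W p hX9 hK hH hP hnt hpD hpN hI (by omega) hq hv
  exact Literature.NumberTheory.EllipticCurves.Rank1Residual.X9.mu_eq_zero_of_bsdp W p hBCS hGr h5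
    hmodP hmodL hGZK (classX9_census_of_classX9 W p hX9) hr0 hbsd hcert

end Summit.BirchSwinnertonDyer.BirchSwinnertonDyer.Rank1Residual

end
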